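import Summits.AtomisticToContinuum.FouriersLaw.Theorems.HonestZwanzigFeshbachIdentitiesContinuity
import Summits.AtomisticToContinuum.FouriersLaw.Theorems.HonestZwanzigFeshbachIdentitiesResolventA
import Summits.AtomisticToContinuum.FouriersLaw.Theorems.HonestZwanzigFeshbachIdentitiesKolmogorov
import Summits.AtomisticToContinuum.FouriersLaw.Theorems.OddSectorIrreversibilityOddDensityIsCorrectorDetailedBalance
import Summits.AtomisticToContinuum.FouriersLaw.Theorems.BondHeatUncertaintySubdiffusiveBondHeatLaplaceUnique

/-!
# `HonestZwanzig.FeshbachIdentities`, part 9: time reversal of equilibrium correlations (kernel detailed balance)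

Support file for item `stmt-AtomisticToContinuum-12697` (`HonestZwanzig.FeshbachIdentities`), clause (ii): for the
pinned anharmonic chain with all parameters positive, `N ≥ 2`, equal bath temperatures `T > 0`, nice observables
`f, g` and `t ≥ 0`,

  `∫ f · P_t g dμ_T = ∫ (g∘Θ) · P_t (f∘Θ) dμ_T`,   `Θ(q,p) = (q,-p)`,

i.e. the `L²(μ_T)`-adjoint of the equilibrium semigroup is the momentum-flipped semigroup (generalised detailed
balance). Proof: both sides are continuous bounded functions of `t` (part 4) with the same Laplace transform — the
resolvent detailed balance `⟨A, R_λ B⟩ = ⟨R_λ(A∘Θ), B∘Θ⟩` of `…OddDensityIsCorrectorDetailedBalance` (Dynkin in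
resolvent form, `L† = ΘLΘ` on test functions, density of `(λ - L)C_c^∞` in `L²(μ_T)`) and Fubini (part 5) — so they
agree by Laplace uniqueness (`stub_laplaceUnique`). `pinnedChain_corr_flip` is the truncated-correlation form
`corr(f,g)(t) = corr(g∘Θ, f∘Θ)(t)` used by the route, and `pinnedChain_kolmogorov_lap_flip` the Kolmogorov identity
with the generator in the FIRST slot, `s·lap_s(e,g) - cov(e,g) = lap_s((Le)∘Θ, g)` for even `e` (time reversal twice
around the second-slot identity of part 3).
-/

noncomputable section

open MeasureTheory ProbabilityTheory Filter Topology Set Function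
open scoped NNReal ENNReal
open Literature.MathematicalPhysics.KineticTheory.HeatConduction
open Literature.MathematicalPhysics.KineticTheory Literature.Probability.Process OscillatorChain
open Summit.AtomisticToContinuum.FouriersLaw.Theorems.SubdiffusiveBondHeat
open Summit.AtomisticToContinuum.FouriersLaw.Theorems.OddSectorIrreversibility
open Summit.AtomisticToContinuum.FouriersLaw.Theorems.ExtensiveSnapshotIrreversibility.ClausiusBudget

namespace Summit.AtomisticToContinuum.FouriersLaw.Theorems.HonestZwanzig

variable {N : ℕ}

section PinnedTR

variable {ω₂ lam β γ : ℝ} (hω : 0 < ω₂) (hl : 0 ≤ lam) (hβ : 0 < β) (hγ : 0 < γ) (hN : 2 ≤ N)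
  {T : ℝ} (hT : 0 < T)
include hω hl hβ hγ hN hT

/-! ### Uniform bound on `⟨F, P_u g⟩` -/

omit hN in
/-- **A `u`-uniform bound**: for nice `f, g` (`0 < ϑ`, `2ϑ < 1/T`) and all `u ≥ 0`,
`|⟨f, P_u g⟩_{μ_T}| ≤ (∫ f² dμ_T + ∫ g² dμ_T)/2` (weighted Cauchy–Schwarz and the `L²(μ_T)`-contraction). [folklore] -/
theorem pinnedChain_abs_integral_mul_act_le_nice (hN0 : 0 < N) {ϑ : ℝ} (hϑ0 : 0 < ϑ) (h2ϑ : 2 * ϑ < 1 / T)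
    {f g : PhaseSpace N → ℝ} (hf : Continuous f) (hg : Continuous g) {Cf Cg : ℝ}
    (hfb : ∀ y, |f y| ≤ Cf * Real.exp (ϑ * (pinnedChain ω₂ lam β γ).hamiltonian N y))
    (hgb : ∀ y, |g y| ≤ Cg * Real.exp (ϑ * (pinnedChain ω₂ lam β γ).hamiltonian N y)) (u : ℝ≥0) :
    |∫ z, f z * (∫ y, g y ∂((pinnedChain ω₂ lam β γ).transitionKernel N T T u z)) ∂((pinnedChain ω₂ lam β γ).gibbsMeasure N T)| ≤
      ((∫ z, f z ^ 2 ∂((pinnedChain ω₂ lam β γ).gibbsMeasure N T)) +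
        ∫ z, g z ^ 2 ∂((pinnedChain ω₂ lam β γ).gibbsMeasure N T)) / 2 := by
  obtain ⟨hg2, hP2, hle⟩ := pinnedChain_integral_sq_act_le hω hl hβ hγ hN0 hT hϑ0 h2ϑ hg hgb u
  have hf2 : Integrable (fun z => f z ^ 2) ((pinnedChain ω₂ lam β γ).gibbsMeasure N T) :=
    (pinnedChain_integral_sq_act_le hω hl hβ hγ hN0 hT hϑ0 h2ϑ hf hfb 0).1
  have h := abs_integral_mul_le_weighted hf2 hP2 one_pos
  rw [inv_one, one_mul, one_mul] at h
  linarith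

/-! ### Time reversal of equilibrium correlations -/

/-- **Kernel detailed balance under momentum reversal, time domain.** For the pinned anharmonic chain with all
parameters positive, `N ≥ 2`, equal bath temperatures `T > 0`, nice observables `f, g` (`0 < ϑ`, `2ϑ < 1/T`) and
every `t ≥ 0`: `∫ f · P_t g dμ_T = ∫ (g∘Θ) · P_t (f∘Θ) dμ_T`, `Θ(q,p) = (q,-p)`. Proof: both sides are continuous
bounded functions of `t` (`pinnedChain_continuous_corr_of_sq_integrable`) whose Laplace transforms at `λ > 0` are
`⟨f, R_λ g⟩` and `⟨g∘Θ, R_λ(f∘Θ)⟩`; these agree by the detailed balance of the equilibrium RESOLVENT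
`⟨A, R_λ B⟩ = ⟨R_λ(A∘Θ), B∘Θ⟩` (`pinnedChain_resolvent_detailed_balance`: Dynkin in resolvent form, `L† = ΘLΘ` on test
functions, density of `(λ - L)C_c^∞` by hypoellipticity and the energy estimate); Laplace uniqueness
(`stub_laplaceUnique`) concludes. [cite: CuneoEckmannHairerReyBellet2018, §3.1] -/
theorem pinnedChain_integral_mul_act_flip {ϑ : ℝ} (hϑ0 : 0 < ϑ) (h2ϑ : 2 * ϑ < 1 / T)
    {f g : PhaseSpace N → ℝ} (hf : Continuous f) (hg : Continuous g) {Cf Cg : ℝ} (hCf : 0 ≤ Cf) (hCg : 0 ≤ Cg)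
    (hfb : ∀ y, |f y| ≤ Cf * Real.exp (ϑ * (pinnedChain ω₂ lam β γ).hamiltonian N y))
    (hgb : ∀ y, |g y| ≤ Cg * Real.exp (ϑ * (pinnedChain ω₂ lam β γ).hamiltonian N y)) {t : ℝ} (ht : 0 ≤ t) :
    ∫ z, f z * (∫ y, g y ∂((pinnedChain ω₂ lam β γ).transitionKernel N T T t.toNNReal z))
        ∂((pinnedChain ω₂ lam β γ).gibbsMeasure N T) =
      ∫ z, g (z.1, -z.2) * (∫ y, f (y.1, -y.2) ∂((pinnedChain ω₂ lam β γ).transitionKernel N T T t.toNNReal z))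
        ∂((pinnedChain ω₂ lam β γ).gibbsMeasure N T) := by
  have hN0 : 0 < N := by omega
  have hϑ1 : ϑ < 1 / T := by linarith
  set P := pinnedChain ω₂ lam β γ with hP
  set μ := P.gibbsMeasure N T with hμ
  haveI : IsProbabilityMeasure μ := pinnedChain_isProbabilityMeasure_gibbsMeasure hω hl hβ.le γ N hT
  obtain ⟨K, c, -, hc, hb⟩ := pinnedChain_harris_bound hω hl hβ hγ hN0 hT hϑ0 hϑ1
  -- the flipped observables are nice
  have hHΘ : ∀ y : PhaseSpace N, P.hamiltonian N (y.1, -y.2) = P.hamiltonian N y :=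
    fun y => OscillatorChain.hamiltonian_neg_momentum P N y
  have hfΘ : Continuous fun y : PhaseSpace N => f (y.1, -y.2) := continuous_comp_flip hf
  have hgΘ : Continuous fun y : PhaseSpace N => g (y.1, -y.2) := continuous_comp_flip hg
  have hfΘb : ∀ y, |f (y.1, -y.2)| ≤ Cf * Real.exp (ϑ * P.hamiltonian N y) := fun y => by
    have := hfb (y.1, -y.2); rwa [hHΘ] at this
  have hgΘb : ∀ y, |g (y.1, -y.2)| ≤ Cg * Real.exp (ϑ * P.hamiltonian N y) := fun y => by
    have := hgb (y.1, -y.2); rwa [hHΘ] at this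
  -- the two continuous bounded functions of time
  set α : ℝ → ℝ := fun s => ∫ z, f z * (∫ y, g y ∂(P.transitionKernel N T T s.toNNReal z)) ∂μ with hα
  set β' : ℝ → ℝ := fun s => ∫ z, g (z.1, -z.2) * (∫ y, f (y.1, -y.2) ∂(P.transitionKernel N T T s.toNNReal z)) ∂μ
    with hβ'
  have hf2 : Integrable (fun z => f z ^ 2) μ := pinnedChain_integrable_sq_nice hω hl hβ hT h2ϑ hf hfb
  have hg2 : Integrable (fun z => g z ^ 2) μ := pinnedChain_integrable_sq_nice hω hl hβ hT h2ϑ hg hgb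
  have hgΘ2 : Integrable (fun z => g (z.1, -z.2) ^ 2) μ := pinnedChain_integrable_sq_nice hω hl hβ hT h2ϑ hgΘ hgΘb
  have hfΘ2 : Integrable (fun z => f (z.1, -z.2) ^ 2) μ := pinnedChain_integrable_sq_nice hω hl hβ hT h2ϑ hfΘ hfΘb
  have hαc : Continuous α :=
    pinnedChain_continuous_corr_of_sq_integrable hω hl hβ hγ hN0 hT hϑ0 h2ϑ hf.stronglyMeasurable hf2 hg hgb
  have hβc : Continuous β' :=
    pinnedChain_continuous_corr_of_sq_integrable hω hl hβ hγ hN0 hT hϑ0 h2ϑ hgΘ.stronglyMeasurable hgΘ2 hfΘ hfΘb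
  set Mα : ℝ := ((∫ z, f z ^ 2 ∂μ) + ∫ z, g z ^ 2 ∂μ) / 2 with hMα
  set Mβ : ℝ := ((∫ z, g (z.1, -z.2) ^ 2 ∂μ) + ∫ z, f (z.1, -z.2) ^ 2 ∂μ) / 2 with hMβ
  have hαb : ∀ u : ℝ≥0, |∫ z, f z * (∫ y, g y ∂(P.transitionKernel N T T u z)) ∂μ| ≤ Mα := fun u =>
    pinnedChain_abs_integral_mul_act_le_nice hω hl hβ hγ hT hN0 hϑ0 h2ϑ hf hg hfb hgb u
  have hβb : ∀ u : ℝ≥0, |∫ z, g (z.1, -z.2) * (∫ y, f (y.1, -y.2) ∂(P.transitionKernel N T T u z)) ∂μ| ≤ Mβ := fun u =>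
    pinnedChain_abs_integral_mul_act_le_nice hω hl hβ hγ hT hN0 hϑ0 h2ϑ hgΘ hfΘ hgΘb hfΘb u
  -- their difference `φ` has zero Laplace transform
  set φ : ℝ → ℝ := fun s => α s - β' s with hφ
  have hlap : ∀ lam' : ℝ, 0 < lam' → ∫ s in Ioi (0 : ℝ), Real.exp (-(lam' * s)) * φ s = 0 := by
    intro lam' hlam
    have hIα := pinnedChain_integrableOn_lapIntegrand hω hl hβ hγ hf hg hαb hlam
    have hIβ := pinnedChain_integrableOn_lapIntegrand hω hl hβ hγ hgΘ hfΘ hβb hlam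
    have hsplit : (fun s : ℝ => Real.exp (-(lam' * s)) * φ s) =
        fun s => Real.exp (-(lam' * s)) * α s - Real.exp (-(lam' * s)) * β' s := by
      funext s; simp only [hφ]; ring
    rw [hsplit, integral_sub hIα hIβ]
    -- Fubini on both Laplace transforms
    have hE2 : Integrable (fun y => Real.exp (2 * ϑ * P.hamiltonian N y)) μ :=
      pinnedChain_integrable_exp_mul_hamiltonian_gibbsMeasure hω hl hβ.le γ N hT h2ϑ
    have hexp : IntegrableOn (fun t : ℝ => Real.exp (-(lam' * t))) (Ioi 0) := by
      have := exp_neg_integrableOn_Ioi 0 hlam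
      refine this.congr (Eventually.of_forall fun t => ?_); simp [neg_mul]
    have hFα := pinnedChain_integral_mul_setIntegral_exp_act hω hl hβ hγ hϑ0 hb hc hg hCg hgb μ hE2
      hf.stronglyMeasurable hf2 hexp
    have hFβ := pinnedChain_integral_mul_setIntegral_exp_act hω hl hβ hγ hϑ0 hb hc hfΘ hCf hfΘb μ hE2
      hgΘ.stronglyMeasurable hgΘ2 hexp
    rw [← hFα, ← hFβ]
    -- detailed balance of the resolvent
    have hDB := pinnedChain_resolvent_detailed_balance hω hl hβ hγ hN hT hϑ0 h2ϑ hf hg hCf hCg hfb hgb hlam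
    rw [hDB, sub_eq_zero]
    refine integral_congr_ae (Eventually.of_forall fun z => ?_)
    ring
  have h0 := stub_laplaceUnique φ (hαc.sub hβc).continuousOn
    ⟨Mα + Mβ, fun s _ => by
      have h1 := hαb s.toNNReal
      have h2 := hβb s.toNNReal
      simp only [hφ, hα, hβ']
      calc |_ - _| ≤ |_| + |_| := abs_sub _ _
        _ ≤ Mα + Mβ := add_le_add h1 h2⟩ hlap t ht
  simp only [hφ, hα, hβ'] at h0
  linarith

/-- **Time reversal of the truncated correlation** (clause (ii) of `FeshbachIdentities`): for nice `f, g` and `t ≥ 0`,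
`corr(f,g)(t) = corr(g∘Θ, f∘Θ)(t)`, i.e.
`⟨f, P_t g⟩ - μ_T(f)μ_T(g) = ⟨g∘Θ, P_t(f∘Θ)⟩ - μ_T(g∘Θ)μ_T(f∘Θ)` (`μ_T` is `Θ`-invariant).
[cite: CuneoEckmannHairerReyBellet2018, §3.1] -/
theorem pinnedChain_corr_flip {ϑ : ℝ} (hϑ0 : 0 < ϑ) (h2ϑ : 2 * ϑ < 1 / T)
    {f g : PhaseSpace N → ℝ} (hf : Continuous f) (hg : Continuous g) {Cf Cg : ℝ} (hCf : 0 ≤ Cf) (hCg : 0 ≤ Cg)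
    (hfb : ∀ y, |f y| ≤ Cf * Real.exp (ϑ * (pinnedChain ω₂ lam β γ).hamiltonian N y))
    (hgb : ∀ y, |g y| ≤ Cg * Real.exp (ϑ * (pinnedChain ω₂ lam β γ).hamiltonian N y)) {t : ℝ} (ht : 0 ≤ t) :
    (∫ z, f z * (∫ y, g y ∂((pinnedChain ω₂ lam β γ).transitionKernel N T T t.toNNReal z))
        ∂((pinnedChain ω₂ lam β γ).gibbsMeasure N T)) -
      (∫ z, f z ∂((pinnedChain ω₂ lam β γ).gibbsMeasure N T)) *
        (∫ z, g z ∂((pinnedChain ω₂ lam β γ).gibbsMeasure N T)) =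
    (∫ z, g (z.1, -z.2) * (∫ y, f (y.1, -y.2) ∂((pinnedChain ω₂ lam β γ).transitionKernel N T T t.toNNReal z))
        ∂((pinnedChain ω₂ lam β γ).gibbsMeasure N T)) -
      (∫ z, g (z.1, -z.2) ∂((pinnedChain ω₂ lam β γ).gibbsMeasure N T)) *
        (∫ z, f (z.1, -z.2) ∂((pinnedChain ω₂ lam β γ).gibbsMeasure N T)) := by
  rw [pinnedChain_integral_mul_act_flip hω hl hβ hγ hN hT hϑ0 h2ϑ hf hg hCf hCg hfb hgb ht,
    integral_comp_reversal_gibbsMeasure _ N T g, integral_comp_reversal_gibbsMeasure _ N T f, mul_comm]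

end PinnedTR

section PinnedKF

variable {ω₂ lam β γ : ℝ} (hω : 0 < ω₂) (hl : 0 ≤ lam) (hβ : 0 < β) (hγ : 0 < γ) (hN : 2 ≤ N)
  {T : ℝ} (hT : 0 < T)
include hω hl hβ hγ hN hT

/-! ### The flipped Kolmogorov identity -/

/-- **The Kolmogorov identity with the generator in the first slot** (first identity of clause (iii) of
`FeshbachIdentities`): for nice `g, e, ℓ` with `e` EVEN in the momenta and Dynkin's identity `P_r e - e = ∫₀ʳ P_s ℓ`,
and every `s > 0`: `s·lap_s(e, g) - cov(e, g) = lap_s(ℓ∘Θ, g)`. By time reversal (`pinnedChain_corr_flip`) and evenness,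
`lap_s(e,g) = lap_s(g∘Θ, e)` and `cov(e,g) = cov(g∘Θ, e)`; the second-slot identity (`pinnedChain_kolmogorov_lap`) gives
`lap_s(g∘Θ, ℓ)`, which is `lap_s(ℓ∘Θ, g)` by time reversal again. [cite: CuneoEckmannHairerReyBellet2018, §3.1] -/
theorem pinnedChain_kolmogorov_lap_flip {ϑ : ℝ} (hϑ0 : 0 < ϑ) (h2ϑ : 2 * ϑ < 1 / T)
    {g e ℓ : PhaseSpace N → ℝ} (hg : Continuous g) (he : Continuous e) (hℓ : Continuous ℓ) {Cg Ce Cℓ : ℝ}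
    (hCg : 0 ≤ Cg) (hCe : 0 ≤ Ce) (hCℓ : 0 ≤ Cℓ)
    (hgb : ∀ y, |g y| ≤ Cg * Real.exp (ϑ * (pinnedChain ω₂ lam β γ).hamiltonian N y))
    (heb : ∀ y, |e y| ≤ Ce * Real.exp (ϑ * (pinnedChain ω₂ lam β γ).hamiltonian N y))
    (hℓb : ∀ y, |ℓ y| ≤ Cℓ * Real.exp (ϑ * (pinnedChain ω₂ lam β γ).hamiltonian N y))
    (heven : ∀ z : PhaseSpace N, e (z.1, -z.2) = e z)
    (hdyn : ∀ (r : ℝ≥0) (z : PhaseSpace N),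
      (∫ y, e y ∂((pinnedChain ω₂ lam β γ).transitionKernel N T T r z)) - e z =
        ∫ s in (0 : ℝ)..(r : ℝ), ∫ y, ℓ y ∂((pinnedChain ω₂ lam β γ).transitionKernel N T T s.toNNReal z))
    {s : ℝ} (hs : 0 < s) :
    s * (∫ t in Ioi (0 : ℝ), Real.exp (-(s * t)) *
        ((∫ z, e z * (∫ y, g y ∂((pinnedChain ω₂ lam β γ).transitionKernel N T T t.toNNReal z))
            ∂((pinnedChain ω₂ lam β γ).gibbsMeasure N T)) -
          (∫ z, e z ∂((pinnedChain ω₂ lam β γ).gibbsMeasure N T)) *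
            (∫ z, g z ∂((pinnedChain ω₂ lam β γ).gibbsMeasure N T)))) -
      ((∫ z, e z * g z ∂((pinnedChain ω₂ lam β γ).gibbsMeasure N T)) -
        (∫ z, e z ∂((pinnedChain ω₂ lam β γ).gibbsMeasure N T)) *
          (∫ z, g z ∂((pinnedChain ω₂ lam β γ).gibbsMeasure N T))) =
    ∫ t in Ioi (0 : ℝ), Real.exp (-(s * t)) *
        ((∫ z, ℓ (z.1, -z.2) * (∫ y, g y ∂((pinnedChain ω₂ lam β γ).transitionKernel N T T t.toNNReal z))
            ∂((pinnedChain ω₂ lam β γ).gibbsMeasure N T)) -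
          (∫ z, ℓ (z.1, -z.2) ∂((pinnedChain ω₂ lam β γ).gibbsMeasure N T)) *
            (∫ z, g z ∂((pinnedChain ω₂ lam β γ).gibbsMeasure N T))) := by
  have hN0 : 0 < N := by omega
  -- the flipped observables
  have hHΘ : ∀ y : PhaseSpace N, (pinnedChain ω₂ lam β γ).hamiltonian N (y.1, -y.2) = (pinnedChain ω₂ lam β γ).hamiltonian N y :=
    fun y => OscillatorChain.hamiltonian_neg_momentum (pinnedChain ω₂ lam β γ) N y
  have hgΘ : Continuous fun y : PhaseSpace N => g (y.1, -y.2) := continuous_comp_flip hg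
  have hgΘb : ∀ y, |g (y.1, -y.2)| ≤ Cg * Real.exp (ϑ * (pinnedChain ω₂ lam β γ).hamiltonian N y) := fun y => by
    have := hgb (y.1, -y.2); rwa [hHΘ] at this
  have heΘ : (fun y : PhaseSpace N => e (y.1, -y.2)) = e := funext heven
  have hgΘΘ : (fun y : PhaseSpace N => g ((y.1, -y.2).1, -(y.1, -y.2).2)) = g := by
    funext y; simp
  -- Step 1: `lap(e, g) = lap(g∘Θ, e)`
  have hA : ∀ t ∈ Ioi (0 : ℝ), Real.exp (-(s * t)) *
      ((∫ z, e z * (∫ y, g y ∂((pinnedChain ω₂ lam β γ).transitionKernel N T T t.toNNReal z)) ∂((pinnedChain ω₂ lam β γ).gibbsMeasure N T)) - (∫ z, e z ∂((pinnedChain ω₂ lam β γ).gibbsMeasure N T)) * (∫ z, g z ∂((pinnedChain ω₂ lam β γ).gibbsMeasure N T))) =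
      Real.exp (-(s * t)) *
      ((∫ z, g (z.1, -z.2) * (∫ y, e y ∂((pinnedChain ω₂ lam β γ).transitionKernel N T T t.toNNReal z)) ∂((pinnedChain ω₂ lam β γ).gibbsMeasure N T)) -
        (∫ z, g (z.1, -z.2) ∂((pinnedChain ω₂ lam β γ).gibbsMeasure N T)) * (∫ z, e z ∂((pinnedChain ω₂ lam β γ).gibbsMeasure N T))) := by
    intro t ht
    have h := pinnedChain_corr_flip hω hl hβ hγ hN hT hϑ0 h2ϑ he hg hCe hCg heb hgb (le_of_lt ht)
    rw [heΘ] at h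
    rw [h]
  -- Step 2: `cov(e, g) = cov(g∘Θ, e)`
  have hB1 : ∫ z, g (z.1, -z.2) * e z ∂((pinnedChain ω₂ lam β γ).gibbsMeasure N T) = ∫ z, e z * g z ∂((pinnedChain ω₂ lam β γ).gibbsMeasure N T) := by
    have h := integral_comp_reversal_gibbsMeasure (pinnedChain ω₂ lam β γ) N T (fun z => g z * e (z.1, -z.2))
    have e1 : (fun z : PhaseSpace N => (fun w : PhaseSpace N => g w * e (w.1, -w.2)) (z.1, -z.2)) =
        fun z => g (z.1, -z.2) * e z := by
      funext z
      simp only [neg_neg, Prod.mk.eta]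
    rw [e1] at h
    rw [h]
    refine integral_congr_ae (Eventually.of_forall fun z => ?_)
    dsimp only
    rw [heven z, mul_comm]
  have hB2 : ∫ z, g (z.1, -z.2) ∂((pinnedChain ω₂ lam β γ).gibbsMeasure N T) = ∫ z, g z ∂((pinnedChain ω₂ lam β γ).gibbsMeasure N T) := integral_comp_reversal_gibbsMeasure (pinnedChain ω₂ lam β γ) N T g
  -- Step 3: the second-slot identity for `f = g∘Θ`
  have hC := pinnedChain_kolmogorov_lap hω hl hβ hγ hN0 hT hϑ0 h2ϑ hgΘ he hℓ hCg hCe hCℓ hgΘb heb hℓb hdyn hs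
  -- Step 4: `lap(g∘Θ, ℓ) = lap(ℓ∘Θ, g)`
  have hD : ∀ t ∈ Ioi (0 : ℝ), Real.exp (-(s * t)) *
      ((∫ z, g (z.1, -z.2) * (∫ y, ℓ y ∂((pinnedChain ω₂ lam β γ).transitionKernel N T T t.toNNReal z)) ∂((pinnedChain ω₂ lam β γ).gibbsMeasure N T)) -
        (∫ z, g (z.1, -z.2) ∂((pinnedChain ω₂ lam β γ).gibbsMeasure N T)) * (∫ z, ℓ z ∂((pinnedChain ω₂ lam β γ).gibbsMeasure N T))) =
      Real.exp (-(s * t)) *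
      ((∫ z, ℓ (z.1, -z.2) * (∫ y, g y ∂((pinnedChain ω₂ lam β γ).transitionKernel N T T t.toNNReal z)) ∂((pinnedChain ω₂ lam β γ).gibbsMeasure N T)) -
        (∫ z, ℓ (z.1, -z.2) ∂((pinnedChain ω₂ lam β γ).gibbsMeasure N T)) * (∫ z, g z ∂((pinnedChain ω₂ lam β γ).gibbsMeasure N T))) := by
    intro t ht
    have h := pinnedChain_corr_flip hω hl hβ hγ hN hT hϑ0 h2ϑ hgΘ hℓ hCg hCℓ hgΘb hℓb (le_of_lt ht)
    rw [hgΘΘ] at h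
    rw [h]
  rw [setIntegral_congr_fun measurableSet_Ioi hA, ← setIntegral_congr_fun measurableSet_Ioi hD, ← hC, hB1, hB2]
  ring

end PinnedKF

end Summit.AtomisticToContinuum.FouriersLaw.Theorems.HonestZwanzig

end
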